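import Literature.AlgebraicGeometry.HodgeTheory.HolonomyFlatCoordinates
import HarnessLib

/-!
# The wedge pairing on the de Rham cohomology of a smooth projective variety is non-degenerate
# in complementary degrees (Poincaré duality read through the de Rham comparison)

Family `hodge`, layer `Literature/AlgebraicGeometry/HodgeTheory`; proof file (theorems only, no
definition, no named fact). Written by the prover seat `hodge-nonav-prover-Bx` (g17, cell `hodge-nonav`)
as the Poincaré-duality input **K4b** of the programme «GRIFFITHS-HOLOMORPHY» (memo
`PROGRAMME-GRIFFITHS-HOLOMORPHY-Bx-g17.md`), companion of `HodgeFiltrationWedgeOrthogonal`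
(hypothesis `hPD` there) and general-degree version of §1 of `HolonomyFlatCoordinates`
(`BettiUniverse.exists_dual_eq_sum_mul_cintegral_wedge`, equal degrees only).

Let `X` be smooth projective of dimension `n`, `B` a Hodge model (carrier `X^an`), `e` a
MULTIPLICATIVE real de Rham comparison, `o` a continuous orientation of `X^an` integrating some closed
top form non-trivially, `k + l = 2n`. Then:

* `BettiUniverse.ofRatClassBaseChange_baseChange_cup_flip`, `HodgeModel.complexification_baseChange_cup_flip`
  — `Θ'`, `Θ_B` are multiplicative for the cup product with a rational class, `(· ∪ y) ⊗ ℂ`, in ALL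
  bidegrees (Hatcher Prop. 3.10; the tree had the equal-degree bilinear case `…_cup2`);
* `BettiUniverse.exists_tr_cup_eq_coord` — Poincaré duality as SURJECTIVITY: every coordinate
  functional of a rational basis of `Hᵏ(X(ℂ); ℚ)` is `v ↦ tr(v ∪ y)` for some `y ∈ Hˡ` (both
  separations `separatingLeft/Right_tr_cup` and a dimension count);
* `BettiUniverse.exists_cintegral_wedge_ne_zero_of_mk_ne_zero` — **every non-zero de Rham class of
  degree `k` on `X^an` pairs non-trivially, under `([θ],[γ]) ↦ ∫ θ ∧ γ`, with some closed `l`-form**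
  (`tr_ℂ = c · ∫` on `H^{2n}`, `BettiUniverse.exists_trC_eq_mul_cintegral`, and multiplicativity of
  `Θ_B` and `e ⊗ ℂ`, Warner Thm. 5.45).

## References

* [VoisinHodgeI2002] C. Voisin, Hodge Theory and Complex Algebraic Geometry I (2002), §5.3.2
  Thm. 5.30, §7.1.2.
* [HatcherAT2002] A. Hatcher, Algebraic Topology (2002), §3.2 Prop. 3.10, §3.3 Prop. 3.38.
* [WarnerGTM94] F. Warner, Foundations of Differentiable Manifolds and Lie Groups (1983), Thm. 5.45.
-/

noncomputable section

open scoped Manifold ContDiff TensorProduct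
open CategoryTheory Module
open Literature.AlgebraicTopology.SingularHomology
open Literature.Geometry.Kaehler
open Literature.NumberTheory.Transcendental
open Literature.AlgebraicGeometry.Motives (bettiCohomology ofRatClassBaseChange
  ofRatClassBaseChange_tmul cintegral ComplexPoints IsSmoothProjective)

-- `TangentSpace I x = E` silently, as in the tree's form files.
set_option backward.isDefEq.respectTransparency false

namespace Literature.AlgebraicGeometry.HodgeTheory

namespace BettiUniverse

section Multiplicative

variable {n : ℕ} {X : Motives.SchemeOver ℂ}

/-- **`Θ'` is multiplicative in all bidegrees, against a rational class**: for `y ∈ Hˡ(X(ℂ); ℚ)`,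
`Θ'((· ∪ y) ⊗ ℂ) x = Θ' x ∪ y` (the cup product is natural in the coefficients; the tree's
`ofRatClassBaseChange_cup2` is the equal-degree bilinear form). [cite: HatcherAT2002, §3.2 Prop. 3.10] -/
theorem ofRatClassBaseChange_baseChange_cup_flip (X : Motives.SchemeOver ℂ) (k l : ℕ)
    (y : bettiCohomology X l) (x : ℂ ⊗[ℚ] bettiCohomology X k) :
    ofRatClassBaseChange (ComplexPoints X) (k + l) (((cup X k l).flip y).baseChange ℂ x) =
      cupProduct rfl (ofRatClassBaseChange (ComplexPoints X) k x)
        (ofRatClass (ComplexPoints X) l y) := by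
  induction x using TensorProduct.induction_on with
  | zero => rw [map_zero, map_zero, map_zero, LinearMap.map_zero₂]
  | tmul c a =>
    rw [LinearMap.baseChange_tmul, ofRatClassBaseChange_tmul, ofRatClassBaseChange_tmul,
      LinearMap.flip_apply, LinearMap.map_smul₂]
    congr 1
    change ofRatClass (ComplexPoints X) (k + l) (cupProduct rfl a y) = _
    rw [ofRatClass_eq_ringChange, ofRatClass_eq_ringChange, ofRatClass_eq_ringChange,
      singularCohomology.ringChange_cupProduct]
  | add x x' hx hx' => rw [map_add, map_add, hx, hx', map_add, LinearMap.map_add₂]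

/-- **`Θ_B` is multiplicative in all bidegrees, against a rational class**:
`Θ_B ((· ∪ y) ⊗ ℂ) x = Θ_B x ∪ Θ_B (1 ⊗ y)` for a Hodge model `B` of the smooth projective `X`
(`Θ'` is, and so is the pull-back `B^*`, `cupProduct_map`). [cite: HatcherAT2002, §3.2 Prop. 3.10] -/
theorem _root_.Literature.AlgebraicGeometry.HodgeTheory.HodgeModel.complexification_baseChange_cup_flip
    (hX : IsSmoothProjective n X) (B : HodgeModel n X) (k l : ℕ) (y : bettiCohomology X l)
    (x : ℂ ⊗[ℚ] bettiCohomology X k) :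
    B.complexification hX (k + l) (((cup X k l).flip y).baseChange ℂ x) =
      cupProduct rfl (B.complexification hX k x) (B.complexification hX l ((1 : ℂ) ⊗ₜ[ℚ] y)) := by
  rw [HodgeModel.complexification_apply, HodgeModel.complexification_apply,
    HodgeModel.complexification_apply, ofRatClassBaseChange_baseChange_cup_flip,
    ofRatClassBaseChange_tmul, one_smul]
  exact cupProduct_map _ rfl _ _

end Multiplicative

section PoincareSurjective

variable {n : ℕ} {X : Motives.SchemeOver ℂ}

/-- **Poincaré duality as surjectivity**: for `X` smooth projective of dimension `n`, `k + l = 2n`,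
and a basis `b` of `Hᵏ(X(ℂ); ℚ)`, every coordinate functional `b.coord i` is `v ↦ tr(v ∪ y)` for some
`y ∈ Hˡ(X(ℂ); ℚ)` (the pairing is separating on both sides, `separatingLeft/Right_tr_cup`, so
`y ↦ tr(· ∪ y)` is an injection between spaces of equal dimension). [cite: HatcherAT2002, §3.3 Prop. 3.38] -/
theorem exists_tr_cup_eq_coord (hX : IsSmoothProjective n X) {k l : ℕ} (h : k + l = 2 * n)
    {ι : Type*} (b : Module.Basis ι ℚ (bettiCohomology X k)) (i : ι) :
    ∃ y : bettiCohomology X l, ∀ v, tr hX (k + l) (cup X k l v y) = b.coord i v := by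
  haveI : Module.Finite ℚ (bettiCohomology X k) := BettiUniverse.finite hX k
  haveI : Module.Finite ℚ (bettiCohomology X l) := BettiUniverse.finite hX l
  set Bq : bettiCohomology X k →ₗ[ℚ] bettiCohomology X l →ₗ[ℚ] ℚ :=
    LinearMap.compr₂ (cup X k l) (tr hX (k + l)) with hBq
  have hL : Bq.SeparatingLeft := separatingLeft_tr_cup hX h
  have hR : Bq.SeparatingRight := separatingRight_tr_cup hX h
  -- `Φ : y ↦ (v ↦ tr (v ∪ y))` is injective, between spaces of the same dimension
  set Φ : bettiCohomology X l →ₗ[ℚ] Module.Dual ℚ (bettiCohomology X k) := Bq.flip with hΦ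
  have hΦinj : Function.Injective Φ :=
    LinearMap.ker_eq_bot.1 (LinearMap.separatingRight_iff_flip_ker_eq_bot.1 hR)
  have hBinj : Function.Injective Bq :=
    LinearMap.ker_eq_bot.1 (LinearMap.separatingLeft_iff_ker_eq_bot.1 hL)
  have h1 : finrank ℚ (bettiCohomology X l) ≤ finrank ℚ (Module.Dual ℚ (bettiCohomology X k)) :=
    LinearMap.finrank_le_finrank_of_injective hΦinj
  have h2 : finrank ℚ (bettiCohomology X k) ≤ finrank ℚ (Module.Dual ℚ (bettiCohomology X l)) :=
    LinearMap.finrank_le_finrank_of_injective hBinj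
  rw [Subspace.dual_finrank_eq] at h1 h2
  have hdim : finrank ℚ (bettiCohomology X l) = finrank ℚ (Module.Dual ℚ (bettiCohomology X k)) := by
    rw [Subspace.dual_finrank_eq]; omega
  have hΦsurj : Function.Surjective Φ :=
    (LinearMap.injective_iff_surjective_of_finrank_eq_finrank hdim).1 hΦinj
  obtain ⟨y, hy⟩ := hΦsurj (b.coord i)
  refine ⟨y, fun v ↦ ?_⟩
  have := LinearMap.congr_fun hy v
  simpa [hΦ, hBq] using this

end PoincareSurjective

section WedgePairing

variable {n : ℕ} {X : Motives.SchemeOver ℂ}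

/-- **The wedge pairing on de Rham cohomology is left non-degenerate in complementary degrees.**
`X` smooth projective of dimension `n`, `B` a Hodge model, `e` a multiplicative real de Rham
comparison on manifolds charted on `B.model`, `o` a continuous orientation of `X^an` integrating some
closed top form non-trivially, `k + l = N = 2n = dim_ℝ X^an`. Then for every closed complex `k`-form
`θ` on `X^an` with non-zero de Rham class there is a closed `l`-form `γ` with `∫_{X^an} θ ∧ γ ≠ 0`.
Proof: carry `[θ]` to `w ∈ ℂ ⊗_ℚ Hᵏ(X(ℂ); ℚ)` along `Θ_B⁻¹ ∘ (e ⊗ ℂ)`; some coordinate of `w` in a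
rational basis is non-zero; that coordinate is `tr_ℂ(w ∪ (1 ⊗ y))` for a Poincaré-dual `y ∈ Hˡ`
(`exists_tr_cup_eq_coord`); represent `Θ_B(1 ⊗ y)` by a closed form `γ`; `Θ_B`, `e ⊗ ℂ` are
multiplicative and `tr_ℂ = c · ∫`, `c ≠ 0` (`exists_trC_eq_mul_cintegral`). This is the hypothesis
`hPD` of `mem_hodgeFiltration_of_forall_cintegral_wedge_eq_zero` (`HodgeFiltrationWedgeOrthogonal`).
[cite: VoisinHodgeI2002, §7.1.2 and §5.3.2 Thm. 5.30] [cite: HatcherAT2002, §3.3 Prop. 3.38]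
[cite: WarnerGTM94, Thm. 5.45] -/
theorem exists_cintegral_wedge_ne_zero_of_mk_ne_zero (hX : IsSmoothProjective n X) (B : HodgeModel n X)
    (e : DeRhamIsoFamily 𝓘(ℝ, B.model)) (hem : e.IsMultiplicative) {k l N : ℕ} (hkl : k + l = N)
    (hN : N = 2 * n) [MeasurableSpace B.model] [BorelSpace B.model] [Fact (finrank ℝ B.model = N)]
    (o : (x : B.carrier) → Orientation ℝ (TangentSpace 𝓘(ℝ, B.model) x) (Fin N))
    (ho : IsContinuousOrientation o)
    (hI : ∃ F : cclosedSmoothForms B.model B.carrier N,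
      cintegral o (F : MForm 𝓘(ℝ, B.model) B.carrier ℂ N) ≠ 0)
    (θ : cclosedSmoothForms B.model B.carrier k)
    (hθ : complexDeRhamCohomology.mk B.model B.carrier k θ ≠ 0) :
    ∃ γ : cclosedSmoothForms B.model B.carrier l,
      cintegral o (((θ : MForm 𝓘(ℝ, B.model) B.carrier ℂ k).wedge
        (γ : MForm 𝓘(ℝ, B.model) B.carrier ℂ l)).castDeg hkl) ≠ 0 := by
  classical
  subst hkl
  haveI : WedgeFacts 𝓘(ℝ, B.model) B.carrier ℝ :=
    wedgeFacts_of_assoc 𝓘(ℝ, B.model) B.carrier ℝ (ContinuousAlternatingMap.WedgeAssoc_holds ℝ B.model ℝ)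
  haveI : WedgeFacts 𝓘(ℝ, B.model) B.carrier ℂ :=
    wedgeFacts_of_assoc 𝓘(ℝ, B.model) B.carrier ℂ (ContinuousAlternatingMap.WedgeAssoc_holds ℝ B.model ℂ)
  haveI : Module.Finite ℚ (bettiCohomology X k) := BettiUniverse.finite hX k
  -- `tr_ℂ = c · ∫` on the top degree
  obtain ⟨c, hc0, hc⟩ := exists_trC_eq_mul_cintegral hX B e hN o ho hI
  -- the Betti avatar `w` of `[θ]`
  set w : ℂ ⊗[ℚ] bettiCohomology X k :=
    (B.complexification hX k).symm (e.complexifyEquiv B.carrier k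
      (complexDeRhamCohomology.mk B.model B.carrier k θ)) with hw_def
  have hw : B.complexification hX k w =
      complexifyFun e k (complexDeRhamCohomology.mk B.model B.carrier k θ) := by
    rw [hw_def, LinearEquiv.apply_symm_apply, complexifyEquiv_apply]
  have hw0 : w ≠ 0 := by
    intro h0
    apply hθ
    have : e.complexifyEquiv B.carrier k (complexDeRhamCohomology.mk B.model B.carrier k θ) = 0 := by
      rw [complexifyEquiv_apply, ← hw, h0, map_zero]
    exact (LinearEquiv.map_eq_zero_iff _).1 this
  -- a rational basis; some coordinate of `w` is non-zero
  set b := Module.finBasis ℚ (bettiCohomology X k) with hb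
  set bC := Algebra.TensorProduct.basis ℂ b with hbC
  obtain ⟨i, hi⟩ : ∃ i, bC.repr w i ≠ 0 := by
    by_contra hall
    push Not at hall
    exact hw0 (bC.ext_elem fun i ↦ by rw [hall i, map_zero, Finsupp.zero_apply])
  -- the Poincaré-dual partner `y` of the `i`-th coordinate
  obtain ⟨y, hy⟩ := exists_tr_cup_eq_coord hX hN b i
  -- `bC.repr w i = tr_ℂ (w ∪ (1 ⊗ y))`
  have hcoord : bC.repr w i =
      trC hX (k + l) (((cup X k l).flip y).baseChange ℂ w) := by
    have hL : bC.coord i = trC hX (k + l) ∘ₗ ((cup X k l).flip y).baseChange ℂ := by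
      refine bC.ext fun j ↦ ?_
      rw [Module.Basis.coord_apply, Module.Basis.repr_self, LinearMap.comp_apply, hbC,
        Algebra.TensorProduct.basis_apply, LinearMap.baseChange_tmul, LinearMap.flip_apply,
        trC_one_tmul, hy, Module.Basis.coord_apply, Module.Basis.repr_self]
      by_cases hij : j = i
      · subst hij
        simp
      · simp [hij]
    have := LinearMap.congr_fun hL w
    rwa [Module.Basis.coord_apply] at this
  -- a closed form `γ` representing `Θ_B (1 ⊗ y)`
  obtain ⟨γ, hγ⟩ : ∃ γ : cclosedSmoothForms B.model B.carrier l,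
      B.complexification hX l ((1 : ℂ) ⊗ₜ[ℚ] y) =
        complexifyFun e l (complexDeRhamCohomology.mk B.model B.carrier l γ) := by
    obtain ⟨γ, hγ⟩ := complexDeRhamCohomology.mk_surjective
      ((e.complexifyEquiv B.carrier l).symm (B.complexification hX l ((1 : ℂ) ⊗ₜ[ℚ] y)))
    refine ⟨γ, ?_⟩
    rw [← complexifyEquiv_apply, hγ, LinearEquiv.apply_symm_apply]
  refine ⟨γ, fun hint ↦ hi ?_⟩
  -- `tr_ℂ (w ∪ (1 ⊗ y)) = c · ∫ θ ∧ γ = 0`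
  have hcl : ((θ : MForm 𝓘(ℝ, B.model) B.carrier ℂ k).wedge
      (γ : MForm 𝓘(ℝ, B.model) B.carrier ℂ l)) ∈ cclosedSmoothForms B.model B.carrier (k + l) :=
    wedge_mem_cclosedSmoothForms θ.2 γ.2
  have hpair : trC hX (k + l) (((cup X k l).flip y).baseChange ℂ w) =
      c * cintegral o (((θ : MForm 𝓘(ℝ, B.model) B.carrier ℂ k).wedge
        (γ : MForm 𝓘(ℝ, B.model) B.carrier ℂ l))) := by
    refine hc _ ⟨_, hcl⟩ ?_
    rw [HodgeModel.complexification_baseChange_cup_flip hX B, hw, hγ, cupProduct_complexifyFun_mk hem rfl]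
    rfl
  rw [hcoord, hpair]
  rw [MForm.castDeg_rfl] at hint
  rw [hint, mul_zero]

end WedgePairing

end BettiUniverse

end Literature.AlgebraicGeometry.HodgeTheory

end
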